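import Literature.NumberTheory.Automorphic.ReciprocityGLn

/-!
# Line `Sketch` for `ResidualBianchiDoorLevel` (stmt-Langlands-15112): in `stub_predictedPolyCongr`
# the hypothesis `Odd q` is load-bearing — at `q = 2` the `m = 2` prediction is NOT congruent

Negative-side lemma (refuter cdisprove seat, 2026-08-16; supports stmt-Langlands-15112; concerns the
stub `stub_predictedPolyCongr` of the picked line `Cruxes/ResidualBianchiDoorLevel/Lines/Sketch.lean`,
not the crux itself).

The stub asserts, for `q` ODD: if `Q ∈ ℤ̄₂[X]` maps to `ι⁻¹ H`, `H = (X-β₁)(X-β₂)` monic, then every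
coefficient of `arithFrobPolyOfSatake ι q 2 {(√q)^{k-1}β₁⁻¹, (√q)^{k-1}β₂⁻¹} = (X - β₁/√q^k)(X - β₂/√q^k)`
(read through `ι⁻¹`) is within 2-adic distance `< 1` of the corresponding coefficient of `Q`
(because `ι⁻¹√q` is a unit `≡ 1 mod 𝔪_{ℤ̄₂}`).

* `stub_predictedPolyCongr_false_without_odd` — with `Odd q` deleted (statement inline, `q` made
  explicit) this is FALSE: `q = 2`, `k = 2`, `H = Q = (X - 1)²` give the prediction `(X - 1/2)²`, and
  the constant coefficients differ by `1 - 1/4 = 3/4`, of 2-adic norm `4 ≥ 1`.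

Moral: the congruence normalisation of the crux only works at places of ODD residue characteristic —
consistent with (and a kernel-checked reason for) the requirement `2 ∈ S₀` in E1′/E2′.
-/

noncomputable section

set_option linter.dupNamespace false

namespace Summit.Langlands.Langlands.Theorems.ResidualBianchiDoorLevel.Negative

open scoped Valued
open Polynomial Literature.NumberTheory.Automorphic

/-- `‖3/4‖₂ = 4` in `ℚ̄₂`. [folklore] -/
theorem norm_three_div_four : ‖(3 / 4 : PadicAlgCl 2)‖ = 4 := by
  haveI : Fact (Nat.Prime 2) := ⟨Nat.prime_two⟩
  have hcoe : (3 / 4 : PadicAlgCl 2) = ((3 / 4 : ℚ_[2]) : PadicAlgCl 2) := by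
    rw [map_div₀, map_ofNat, map_ofNat]
  have h3 : ‖(3 : ℚ_[2])‖ = 1 := by
    have hle : ‖((3 : ℤ) : ℚ_[2])‖ ≤ 1 := Padic.norm_int_le_one 3
    have hlt : ¬ ‖((3 : ℤ) : ℚ_[2])‖ < 1 := by
      rw [Padic.norm_intCast_lt_one_iff]
      norm_num
    have : ((3 : ℤ) : ℚ_[2]) = 3 := by norm_num
    rw [this] at hle hlt
    exact le_antisymm hle (not_lt.mp hlt)
  have h4 : ‖(4 : ℚ_[2])‖ = 4⁻¹ := by
    have e : (4 : ℚ_[2]) = ((2 : ℕ) : ℚ_[2]) ^ 2 := by norm_num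
    rw [e, norm_pow, Padic.norm_p]
    norm_num
  rw [hcoe, PadicAlgCl.norm_extends, norm_div, h3, h4]
  norm_num

/-- **`Odd q` is load-bearing in `stub_predictedPolyCongr`.**  The stub of the line `Sketch` with
its hypothesis `(hq : Odd q)` deleted (`q` explicit, everything else verbatim) is false: at `q = 2`,
`k = 2`, `Q = H = (X - 1)²` the `X⁰`-coefficients of `Q` and of the prediction `(X - 1/2)²` differ by
`3/4`, whose 2-adic norm is `4`, not `< 1`. [folklore] -/
theorem stub_predictedPolyCongr_false_without_odd :
    ¬ ∀ (ι : PadicAlgCl 2 ≃+* ℂ) (q : ℕ) (k : ℤ) (Q : Polynomial 𝒪[PadicAlgCl 2])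
        (H : Polynomial ℂ), H.Monic → H.natDegree = 2 →
        Q.map (𝒪[PadicAlgCl 2]).subtype = H.map (ι.symm : ℂ →+* PadicAlgCl 2) →
        ∀ i : ℕ, ‖(Q.map (𝒪[PadicAlgCl 2]).subtype).coeff i -
          (arithFrobPolyOfSatake ι q 2
            (H.roots.map fun β => (((Real.sqrt q : ℝ) : ℂ)) ^ (k - 1) * β⁻¹)).coeff i‖ < 1 := by
  haveI : Fact (Nat.Prime 2) := ⟨Nat.prime_two⟩
  intro h
  -- `∀ ι` over an empty type would be vacuous: produce an abstract `ι : ℚ̄₂ ≃+* ℂ` (Steinitz)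
  obtain ⟨ι⟩ : Nonempty (PadicAlgCl 2 ≃+* ℂ) := by
    have hQ2 : Cardinal.mk ℚ_[2] = Cardinal.continuum := by
      apply le_antisymm
      · change Cardinal.mk (Quotient (CauSeq.equiv : Setoid (CauSeq ℚ (padicNorm 2)))) ≤
          Cardinal.continuum
        refine (Cardinal.mk_quotient_le
          (s := (CauSeq.equiv : Setoid (CauSeq ℚ (padicNorm 2))))).trans ?_
        refine (Cardinal.mk_subtype_le _).trans_eq ?_
        rw [← Cardinal.power_def, Cardinal.mk_nat, Cardinal.mkRat, Cardinal.aleph0_power_aleph0]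
      · exact continuum_le_cardinal_of_nontriviallyNormedField ℚ_[2]
    have hC2 : Cardinal.mk (PadicAlgCl 2) = Cardinal.continuum := by
      apply le_antisymm
      · refine (Algebra.IsAlgebraic.cardinalMk_le_max ℚ_[2] (PadicAlgCl 2)).trans ?_
        rw [hQ2, max_eq_left Cardinal.aleph0_le_continuum]
      · rw [← hQ2]
        exact Cardinal.mk_le_of_injective (algebraMap ℚ_[2] (PadicAlgCl 2)).injective
    refine IsAlgClosed.ringEquiv_of_equiv_of_charZero ?_
      (Cardinal.eq.1 (by rw [hC2, Cardinal.mk_complex]))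
    rw [hC2]
    exact Cardinal.aleph0_lt_continuum
  -- the witness `q = 2`, `k = 2`, `Q = H = (X - 1)²`
  set Q : Polynomial 𝒪[PadicAlgCl 2] := (X - C 1) ^ 2 with hQdef
  set H : Polynomial ℂ := (X - C 1) ^ 2 with hHdef
  have hH : H.Monic := (monic_X_sub_C 1).pow 2
  have hdeg : H.natDegree = 2 := by
    rw [hHdef, natDegree_pow, natDegree_X_sub_C]
  have hQmap : Q.map (𝒪[PadicAlgCl 2]).subtype = (X - C 1) ^ 2 := by
    rw [hQdef, Polynomial.map_pow, Polynomial.map_sub, map_X, map_C, map_one]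
  have hHmap : H.map (ι.symm : ℂ →+* PadicAlgCl 2) = (X - C 1) ^ 2 := by
    rw [hHdef, Polynomial.map_pow, Polynomial.map_sub, map_X, map_C, RingHom.coe_coe, map_one]
  have hroots : H.roots = {1, 1} := by
    rw [hHdef, roots_pow, roots_X_sub_C]; rfl
  have hs : ((Real.sqrt 2 : ℝ) : ℂ) * ((Real.sqrt 2 : ℝ) : ℂ) = 2 := by
    rw [← Complex.ofReal_mul, Real.mul_self_sqrt (by norm_num : (0:ℝ) ≤ 2)]
    norm_num
  -- the prediction is `(X - C 2⁻¹)²`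
  have hpred : arithFrobPolyOfSatake ι 2 2
      (H.roots.map fun β => (((Real.sqrt (2 : ℕ) : ℝ) : ℂ)) ^ ((2 : ℤ) - 1) * β⁻¹) =
      (X - C (2⁻¹ : PadicAlgCl 2)) * (X - C (2⁻¹ : PadicAlgCl 2)) := by
    have hc : ι.symm ((((Real.sqrt (2 : ℕ) : ℝ) : ℂ)) ^ (2 - 1) *
        ((((Real.sqrt (2 : ℕ) : ℝ) : ℂ)) ^ ((2 : ℤ) - 1) * (1 : ℂ)⁻¹))⁻¹ = (2⁻¹ : PadicAlgCl 2) := by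
      norm_num
      rw [← mul_inv, ← map_mul, hs, map_ofNat]
      norm_num
    simp only [arithFrobPolyOfSatake, hroots, Multiset.insert_eq_cons, Multiset.map_cons,
      Multiset.map_singleton, Multiset.prod_cons, Multiset.prod_singleton, hc]
  have h0 := h ι 2 2 Q H hH hdeg (hQmap.trans hHmap.symm) 0
  rw [hQmap, hpred] at h0
  have e1 : ((X - C 1) ^ 2 : Polynomial (PadicAlgCl 2)).coeff 0 = 1 := by
    rw [coeff_zero_eq_eval_zero]; simp
  have e2 : ((X - C (2⁻¹ : PadicAlgCl 2)) * (X - C (2⁻¹ : PadicAlgCl 2))).coeff 0 = 4⁻¹ := by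
    rw [coeff_zero_eq_eval_zero]; norm_num
  rw [e1, e2, show (1 : PadicAlgCl 2) - 4⁻¹ = 3 / 4 by norm_num, norm_three_div_four] at h0
  norm_num at h0

end Summit.Langlands.Langlands.Theorems.ResidualBianchiDoorLevel.Negative

end
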